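import Summits.HodgeConjecture.HodgeConjecture.Theorems.NikulinTwinTransportSquareGlueFreeEndomorphisms
import Summits.HodgeConjecture.HodgeConjecture.Theorems.EndoscopicMiddleDegreeCupProductAlgebraic
import Literature.AlgebraicGeometry.HodgeTheory.ComplexGysinCorrespondence
import Literature.AlgebraicGeometry.HodgeTheory.MotivatedClassesProofs

/-!
# Crux `K3TypeNets` (stmt-HodgeConjecture-11600), product sector — Hodge morphisms `T(S₂) → T(S₁)` that are
# algebraic on the transcendental part come from ALGEBRAIC classes on `S₁ × S₂`

Helper for the product-sector line of crux `K3TypeNets` (`Cruxes/K3TypeNets/Lines/product_sector.lean`, stubs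
P2 `stub_k3Pairs` / P3 `stub_residualPgOnePairs`: "equivalently, every Hodge morphism `T(S₂)_ℚ → T(S₁)_ℚ` of
the transcendental lattices is induced by an algebraic class"). This file and its sibling
`…SurfaceProductsHodge` kernel-check that equivalence in the direction the line needs, for TWO arbitrary
smooth projective complex surfaces `S₁`, `S₂` (the two-surface form of the marking-free bookkeeping
`NikulinTwinTransportSquareGlueFree*`, which is the case `S₁ = S₂`):

* `cupProduct_corrFst_eq_zero_of_orthogonal₂` — `Hom_Hdg(T(S₂), NS(S₁)) = 0` in correspondence form: for a
  rational `(2,2)`-class `z` on `S₁ × S₂`, `pr₁_*(pr₂^* y ∪ z)` is cup-orthogonal to `N¹H²(S₁)` whenever `y`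
  is cup-orthogonal to `N¹H²(S₂)` (transposition identities `cupPairing_corrFst_eq` / `cupPairing_corrSnd_eq`
  and Lefschetz `(1,1)` on `S₂`);
* `corr_mem_algebraicClasses₂` — the action of an ALGEBRAIC class of `S₁ × S₂` maps divisor classes of `S₂`
  to divisor classes of `S₁` (the tree's `corrClassAction_mem_algebraicClasses_of_cupProduct` with the PROVED
  multiplicativity `Voisin2003_cupProduct_algebraicClasses_holds`);
* `exists_algebraicClass_of_corrFst₂` — THE CORRESPONDENCE THEOREM: if every rational type-preserving
  `f : H²(S₂) → H²(S₁)` killing `N¹H²(S₂)` with image orthogonal to `N¹H²(S₁)` agrees on `T(S₂)` with the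
  action of some algebraic class, then for every rational `(2,2)`-class `z` on `S₁ × S₂` there is an
  ALGEBRAIC `Γ` with `[Γ]_* = [z]_*` on `H²(S₂)`: `F = u[z]_*` equals `[γ_f]_*` on `T(S₂)` (`f = π_T F π_T`,
  Néron–Severi projections of both surfaces, `SquareGlueFree.exists_nsProjection_free`), and `F - [γ_f]_*`
  kills `T(S₂)` and maps the rational divisor basis of `S₂` into `N¹H²(S₁)`, so it is the action of a sum of
  exterior products of divisors (`corrFst_cross_of_cup_eq`).

No definition, no named-fact hypothesis, no sorry. Prover seat ring2-b02 (gen 47).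

References: Huybrechts, *Motives of isogenous K3 surfaces* (2019), §1; Varesco (2023), §2 p. 8; Voisin,
*Hodge Theory and Complex Algebraic Geometry I*, §11.3.3 Lemma 11.41, Thm. 11.30; Voisin II, Prop. 9.20;
Fulton, *Young Tableaux*, App. B §B.1.
-/

set_option linter.dupNamespace false

noncomputable section

namespace Summit.HodgeConjecture.HodgeConjecture.Theorems.SurfaceProducts

open scoped Manifold
open CategoryTheory MonoidalCategory CartesianMonoidalCategory
open Literature.AlgebraicGeometry Literature.AlgebraicGeometry.Motives Literature.AlgebraicGeometry.HodgeTheory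
open Literature.AlgebraicTopology.SingularHomology
open Summit.HodgeConjecture.HodgeConjecture.Theorems.NikulinTwinTransport
open Summit.HodgeConjecture.HodgeConjecture.Theorems.NikulinTwinTransport.SquareGlueFree

variable {S₁ S₂ : SchemeOver ℂ}

/-- `Corr[μ, h₁, h₂ ; γ, y] = pr₁_*(pr₂^* y ∪ γ) : H²(S₂(ℂ)) → H²(S₁(ℂ))` for `γ ∈ H⁴((S₁ ⊗ S₂)(ℂ))`
(the first factor receives). Local notation only. -/
local notation3 (prettyPrint := false) "Corr[" μ ", " h₁ ", " h₂ " ; " γ ", " y "]" =>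
  complexGysin μ (IsSmoothProjective.tensor_holds h₁ h₂) h₁
    (SemiCartesianMonoidalCategory.fst _ _) (rfl : 2 * 1 + 2 * 2 + 2 * 2 = 2 * 1 + 2 * (2 + 2))
    (cupProduct (rfl : 2 * 1 + 2 * 2 = 2 * 1 + 2 * 2)
      (complexBetti.map (SemiCartesianMonoidalCategory.snd _ _) (2 * 1) y) γ)

/-- `CorrT[μ, h₁, h₂ ; γ, d] = pr₂_*(pr₁^* d ∪ γ) : H²(S₁(ℂ)) → H²(S₂(ℂ))`, the transposed action. Local
notation only. -/
local notation3 (prettyPrint := false) "CorrT[" μ ", " h₁ ", " h₂ " ; " γ ", " d "]" =>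
  complexGysin μ (IsSmoothProjective.tensor_holds h₁ h₂) h₂
    (SemiCartesianMonoidalCategory.snd _ _) (rfl : 2 * 1 + 2 * 2 + 2 * 2 = 2 * 1 + 2 * (2 + 2))
    (cupProduct (rfl : 2 * 1 + 2 * 2 = 2 * 1 + 2 * 2)
      (complexBetti.map (SemiCartesianMonoidalCategory.fst _ _) (2 * 1) d) γ)

/-! ### `Hom_Hdg(T(S₂), NS(S₁)) = 0`, correspondence form -/

/-- **The action of a rational `(2,2)`-class of `S₁ × S₂` maps the transcendental classes of `S₂` to classes
orthogonal to `N¹H²(S₁)`**: `⟨pr₁_*(pr₂^* y ∪ z), d⟩ = ±⟨z, pr₁^* d ∪ pr₂^* y⟩ = ±⟨pr₂_*(pr₁^* d ∪ z), y⟩` and,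
for rational `d ∈ N¹H²(S₁)`, `pr₂_*(pr₁^* d ∪ z)` is up to one non-zero scalar a rational `(1,1)`-class of `S₂`,
hence in `N¹H²(S₂)` by Lefschetz `(1,1)` and orthogonal to `y`; general `d` are combinations of rational ones.
[cite: VoisinHodgeI2002, §11.3.3 Lemma 11.41 and Thm. 11.30] [cite: Huybrechts2019, §1] -/
theorem cupProduct_corrFst_eq_zero_of_orthogonal₂ (μ : OrientationFamily) (h₁ : IsSmoothProjective 2 S₁)
    (h₂ : IsSmoothProjective 2 S₂) {z : complexBetti (S₁ ⊗ S₂) (2 * 2)} (hzQ : IsRationalClass z)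
    (hzT : IsOfHodgeType (2 + 2) (S₁ ⊗ S₂) (2 * 2) 2 2 z)
    {y : complexBetti S₂ (2 * 1)}
    (hy : ∀ d ∈ algebraicClasses S₂ 1, cupProduct (rfl : 2 * 1 + 2 * 1 = 2 * 2) y d = 0)
    {d : complexBetti S₁ (2 * 1)} (hd : d ∈ algebraicClasses S₁ 1) :
    cupProduct (rfl : 2 * 1 + 2 * 1 = 2 * 2) (Corr[μ, h₁, h₂ ; z, y]) d = 0 := by
  have h4 : 2 * 1 + 2 * 1 = 2 * 2 := rfl
  have hI := hodgePQ_independent_of_hodgeModel_holds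
  have hdR : ∀ (E : Type) [NormedAddCommGroup E] [NormedSpace ℂ E] [FiniteDimensional ℂ E],
      Literature.NumberTheory.Transcendental.exists_deRhamIsoFamily 𝓘(ℝ, E) :=
    fun E _ _ _ ↦ Literature.NumberTheory.Transcendental.exists_deRhamIsoFamily_holds E
  have hSS := IsSmoothProjective.tensor_holds h₁ h₂
  obtain ⟨B, -⟩ := id hzT
  obtain ⟨A₂⟩ := nonempty_hodgeModel_holds (n := 2) (X := S₂) h₂
  obtain ⟨u, hu0, hu⟩ := exists_smul_complexGysin_isRationalClass μ hSS h₂ (snd S₁ S₂)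
    (rfl : 2 * 1 + 2 * 2 + 2 * 2 = 2 * 1 + 2 * (2 + 2))
  have key : ∀ d : complexBetti S₁ (2 * 1), IsRationalClass d → d ∈ algebraicClasses S₁ 1 →
      cupProduct h4 (Corr[μ, h₁, h₂ ; z, y]) d = 0 := by
    intro d hdQ hdN
    set w : complexBetti S₂ (2 * 1) := CorrT[μ, h₁, h₂ ; z, d] with hw
    have hwQ : IsRationalClass (u • w) := hu _ ((IsRationalClass.map _ hdQ).cup _ hzQ)
    have hd11 : IsOfHodgeType 2 S₁ (2 * 1) 1 1 d :=
      isOfHodgeType_of_mem_algebraicClasses_of_isSmoothProjective h₁ 1 hdN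
    have hw11 : IsOfHodgeType 2 S₂ (2 * 1) 1 1 (u • w) := by
      refine (isOfHodgeType_corrSnd hI hdR μ h₁ h₂ B A₂ (rfl : 2 * 1 + 2 * 2 = 2 * 1 + 2 * 2)
        (rfl : 2 * 1 + 2 * 2 + 2 * 2 = 2 * 1 + 2 * (2 + 2)) hzT (r' := 1) (l' := 1)
        (by norm_num) (by norm_num) hd11).smul u
    have hwN : u • w ∈ algebraicClasses S₂ 1 := lefschetzOneOne_rational_holds h₂ (u • w) hwQ hw11
    have hwy : cupProduct h4 w y = 0 := by
      have h1 : cupProduct h4 y (u • w) = 0 := hy _ hwN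
      rw [map_smul, smul_eq_zero] at h1
      rw [cupProduct_gradedComm_holds ℂ _ h4 h4, h1.resolve_left hu0, smul_zero]
    have e1 := cupPairing_corrFst_eq μ h₁ h₂ (k := 2 * 2) (l := 2 * 2) (i := 2 * 1) (j := 2 * 1)
      (rfl : 2 * 2 + 2 * 2 = 2 * (2 + 2)) h4 (rfl : 2 * 1 + 2 * 2 = 2 * 1 + 2 * 2)
      (rfl : 2 * 1 + 2 * 2 + 2 * 2 = 2 * 1 + 2 * (2 + 2)) h4 z d y
    have e2 := cupPairing_corrSnd_eq μ h₁ h₂ (k := 2 * 2) (l := 2 * 2) (i := 2 * 1) (j := 2 * 1)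
      (rfl : 2 * 2 + 2 * 2 = 2 * (2 + 2)) h4 (rfl : 2 * 1 + 2 * 2 = 2 * 1 + 2 * 2)
      (rfl : 2 * 1 + 2 * 2 + 2 * 2 = 2 * 1 + 2 * (2 + 2)) h4 z d y
    have hp2 : cupPairing (μ h₂) h4 (CorrT[μ, h₁, h₂ ; z, d]) y = 0 := by
      rw [cupPairing_apply, ← hw, hwy, map_zero, LinearMap.zero_apply]
    rw [hp2] at e2
    have hz0 : cupPairing (μ hSS) (rfl : 2 * 2 + 2 * 2 = 2 * (2 + 2)) z
        (cupProduct h4 (complexBetti.map (fst S₁ S₂) (2 * 1) d) (complexBetti.map (snd S₁ S₂) (2 * 1) y)) = 0 := by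
      have hsign : ((-1 : ℂ) ^ (2 * 1 * (2 * 2))) ≠ 0 := pow_ne_zero _ (neg_ne_zero.2 one_ne_zero)
      exact (mul_eq_zero.1 e2.symm).resolve_left hsign
    rw [hz0, mul_zero] at e1
    rw [cupPairing_apply] at e1
    exact top_eq_zero_of_kroneckerPairing_eq_zero h₁ (μ h₁) e1
  have hspan := span_isRationalClass_eq_top_of_isSmoothProjective_holds.supportedClasses_eq_span h₁ (2 * 1) 1
  have hd' : d ∈ Submodule.span ℂ {c : complexBetti S₁ (2 * 1) |
      IsRationalClass c ∧ c ∈ supportedClasses S₁ (2 * 1) 1} := by rw [← hspan]; exact hd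
  clear hd
  induction hd' using Submodule.span_induction with
  | mem c hc => exact key c hc.1 hc.2
  | zero => rw [map_zero]
  | add c c' _ _ hc hc' => rw [map_add, hc, hc', add_zero]
  | smul t c _ hc => rw [map_smul, hc, smul_zero]

/-! ### Algebraic correspondences preserve divisor classes -/

/-- **The action of an algebraic class of codimension `2` on `S₁ × S₂` maps `N¹H²(S₂)` into `N¹H²(S₁)`**
(correspondences by algebraic cycles preserve algebraic classes: pull-back, cup product with an algebraic
class — `Voisin2003_cupProduct_algebraicClasses_holds` — and Gysin push-forward; the tree's
`corrClassAction_mem_algebraicClasses_of_cupProduct` read through `corrAction_eq_corrClassAction`).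
[cite: VoisinHodgeII2003, §9.2.4 Prop. 9.20] [cite: Fulton1998, §16.1] -/
theorem corr_mem_algebraicClasses₂ (μ : OrientationFamily) (h₁ : IsSmoothProjective 2 S₁)
    (h₂ : IsSmoothProjective 2 S₂) {γ : complexBetti (S₁ ⊗ S₂) (2 * 2)} (hγ : γ ∈ algebraicClasses (S₁ ⊗ S₂) 2)
    {d : complexBetti S₂ (2 * 1)} (hd : d ∈ algebraicClasses S₂ 1) :
    Corr[μ, h₁, h₂ ; γ, d] ∈ algebraicClasses S₁ 1 := by
  have hSS := IsSmoothProjective.tensor_holds h₁ h₂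
  have h := corrClassAction_mem_algebraicClasses_of_cupProduct h₁ h₂ (μ hSS) (μ h₁)
    (OrientationFamily.hasPoincareDuality μ h₁) (p := 1) (e := 2) (q := 1) (k := 2 * 1)
    (rfl : 2 * 1 + 2 * 2 = 2 * 1 + 2 * 2) (rfl : 2 * 1 + 2 * 1 = 2 * 2)
    (fun x y hx hy ↦ Voisin2003_cupProduct_algebraicClasses_holds hSS hx hy) hγ hd
  rw [← corrAction_eq_corrClassAction μ h₁ h₂ (rfl : 2 * 1 + 2 * 2 = 2 * 1 + 2 * 2) (rfl : 2 * 1 + 2 * 1 = 2 * 2),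
    corrAction_apply] at h
  exact h

/-! ### The correspondence theorem -/

/-- **Correspondence theorem for a product of two surfaces.** Let `S₁`, `S₂` be smooth projective complex
surfaces and `μ` an orientation family, and suppose every rational, type-preserving linear map
`f : H²(S₂(ℂ); ℂ) → H²(S₁(ℂ); ℂ)` killing `N¹H²(S₂)` with image cup-orthogonal to `N¹H²(S₁)` agrees on
`T(S₂) = (N¹H²(S₂))^⊥` with the action `y ↦ pr₁_*(pr₂^* y ∪ γ)` of some ALGEBRAIC `γ ∈ N²H⁴(S₁ × S₂)` ("Hodge
morphisms `T(S₂) → T(S₁)` are algebraic"). Then the action of every rational `(2,2)`-class `z` of `S₁ × S₂` on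
`H²(S₂)` is the action of an algebraic class `Γ`. Two-surface form of
`SquareGlueFree.exists_algebraicClass_of_corrFst`. [cite: Huybrechts2019, §1] [cite: Varesco2023, §2 (p. 8)]
[cite: VoisinHodgeI2002, §11.3.3 Lemma 11.41] -/
theorem exists_algebraicClass_of_corrFst₂ (μ : OrientationFamily) (h₁ : IsSmoothProjective 2 S₁)
    (h₂ : IsSmoothProjective 2 S₂)
    (hT : ∀ (f : complexBetti S₂ (2 * 1) →ₗ[ℂ] complexBetti S₁ (2 * 1)),
      (∀ y, IsRationalClass y → IsRationalClass (f y)) →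
      (∀ (i j : ℕ) y, IsOfHodgeType 2 S₂ (2 * 1) i j y → IsOfHodgeType 2 S₁ (2 * 1) i j (f y)) →
      (∀ d ∈ algebraicClasses S₂ 1, f d = 0) →
      (∀ y : complexBetti S₂ (2 * 1), ∀ d ∈ algebraicClasses S₁ 1,
        cupProduct (rfl : 2 * 1 + 2 * 1 = 2 * 2) (f y) d = 0) →
      ∃ γ ∈ algebraicClasses (S₁ ⊗ S₂) 2, ∀ y : complexBetti S₂ (2 * 1),
        (∀ d ∈ algebraicClasses S₂ 1, cupProduct (rfl : 2 * 1 + 2 * 1 = 2 * 2) y d = 0) →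
        f y = Corr[μ, h₁, h₂ ; γ, y])
    {z : complexBetti (S₁ ⊗ S₂) (2 * 2)} (hzQ : IsRationalClass z)
    (hzT : IsOfHodgeType (2 + 2) (S₁ ⊗ S₂) (2 * 2) 2 2 z) :
    ∃ Γ ∈ algebraicClasses (S₁ ⊗ S₂) 2, ∀ y : complexBetti S₂ (2 * 1),
      Corr[μ, h₁, h₂ ; Γ, y] = Corr[μ, h₁, h₂ ; z, y] := by
  classical
  have h4 : 2 * 1 + 2 * 1 = 2 * 2 := rfl
  have hI := hodgePQ_independent_of_hodgeModel_holds
  have hdR : ∀ (E : Type) [NormedAddCommGroup E] [NormedSpace ℂ E] [FiniteDimensional ℂ E],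
      Literature.NumberTheory.Transcendental.exists_deRhamIsoFamily 𝓘(ℝ, E) :=
    fun E _ _ _ ↦ Literature.NumberTheory.Transcendental.exists_deRhamIsoFamily_holds E
  have hSS := IsSmoothProjective.tensor_holds h₁ h₂
  obtain ⟨B, -⟩ := id hzT
  obtain ⟨A₁⟩ := nonempty_hodgeModel_holds (n := 2) (X := S₁) h₁
  set N₁ : Submodule ℂ (complexBetti S₁ (2 * 1)) := algebraicClasses S₁ 1 with hN₁def
  set N₂ : Submodule ℂ (complexBetti S₂ (2 * 1)) := algebraicClasses S₂ 1 with hN₂def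
  have hN₂11 : ∀ d ∈ N₂, IsOfHodgeType 2 S₂ (2 * 1) 1 1 d :=
    fun d hd ↦ isOfHodgeType_of_mem_algebraicClasses_of_isSmoothProjective h₂ 1 hd
  have hL11 : ∀ c : complexBetti S₁ (2 * 1), IsRationalClass c → IsOfHodgeType 2 S₁ (2 * 1) 1 1 c → c ∈ N₁ :=
    fun c hc h11 ↦ lefschetzOneOne_rational_holds h₁ c hc h11
  -- the action of a class as a linear map
  let CorrL : complexBetti (S₁ ⊗ S₂) (2 * 2) → (complexBetti S₂ (2 * 1) →ₗ[ℂ] complexBetti S₁ (2 * 1)) :=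
    fun γ ↦ (complexGysin μ hSS h₁ (fst S₁ S₂) (rfl : 2 * 1 + 2 * 2 + 2 * 2 = 2 * 1 + 2 * (2 + 2))) ∘ₗ
      ((cupProduct (rfl : 2 * 1 + 2 * 2 = 2 * 1 + 2 * 2)).flip γ) ∘ₗ (complexBetti.map (snd S₁ S₂) (2 * 1)).hom
  have hCorrL : ∀ γ y, CorrL γ y = Corr[μ, h₁, h₂ ; γ, y] := fun γ y ↦ rfl
  obtain ⟨u, hu0, hu⟩ := exists_smul_complexGysin_isRationalClass μ hSS h₁ (fst S₁ S₂)
    (rfl : 2 * 1 + 2 * 2 + 2 * 2 = 2 * 1 + 2 * (2 + 2))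
  set F : complexBetti S₂ (2 * 1) →ₗ[ℂ] complexBetti S₁ (2 * 1) := u • CorrL z with hFdef
  have hF : ∀ y, F y = u • Corr[μ, h₁, h₂ ; z, y] := fun y ↦ rfl
  have hF_rat : ∀ y, IsRationalClass y → IsRationalClass (F y) := fun y hy ↦ by
    rw [hF]
    exact hu _ (IsRationalClass.cup _ (IsRationalClass.map _ hy) hzQ)
  have hF_typ : ∀ (i j : ℕ) y, IsOfHodgeType 2 S₂ (2 * 1) i j y → IsOfHodgeType 2 S₁ (2 * 1) i j (F y) :=
    fun i j y hy ↦ by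
      rw [hF]
      exact (isOfHodgeType_corrFst hI hdR μ h₁ h₂ B A₁ (rfl : 2 * 1 + 2 * 2 = 2 * 1 + 2 * 2)
        (rfl : 2 * 1 + 2 * 2 + 2 * 2 = 2 * 1 + 2 * (2 + 2)) hzT (rfl : i + 2 = i + 2) (rfl : j + 2 = j + 2)
        hy).smul u
  have hF_T : ∀ y, (∀ d ∈ N₂, cupProduct h4 y d = 0) → ∀ d ∈ N₁, cupProduct h4 (F y) d = 0 := by
    intro y hy d hd
    rw [hF, map_smul, LinearMap.smul_apply, cupProduct_corrFst_eq_zero_of_orthogonal₂ μ h₁ h₂ hzQ hzT hy hd,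
      smul_zero]
  -- the two Néron–Severi projections and `f = π_T F π_T`
  obtain ⟨π₁, hπ₁N, hπ₁id, hπ₁T, hπ₁orth, hπ₁Q, hπ₁typ⟩ := exists_nsProjection_free h₁
  obtain ⟨π₂, hπ₂N, hπ₂id, hπ₂T, hπ₂orth, hπ₂Q, hπ₂typ⟩ := exists_nsProjection_free h₂
  set f : complexBetti S₂ (2 * 1) →ₗ[ℂ] complexBetti S₁ (2 * 1) :=
    (LinearMap.id - π₁) ∘ₗ F ∘ₗ (LinearMap.id - π₂) with hfdef
  have hf : ∀ y, f y = F (y - π₂ y) - π₁ (F (y - π₂ y)) := fun y ↦ by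
    simp only [hfdef, LinearMap.comp_apply, LinearMap.sub_apply, LinearMap.id_apply]
  have hf_rat : ∀ y, IsRationalClass y → IsRationalClass (f y) := fun y hy ↦ by
    rw [hf]
    have h1 : IsRationalClass (F (y - π₂ y)) := hF_rat _ (isRationalClass_sub hy (hπ₂Q y hy))
    exact isRationalClass_sub h1 (hπ₁Q _ h1)
  have hf_typ : ∀ (i j : ℕ) y, IsOfHodgeType 2 S₂ (2 * 1) i j y → IsOfHodgeType 2 S₁ (2 * 1) i j (f y) :=
    fun i j y hy ↦ by
      rw [hf]
      exact (hπ₁typ i j _ (hF_typ i j _ (hπ₂typ i j y hy).2)).2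
  have hf_N : ∀ d ∈ N₂, f d = 0 := fun d hd ↦ by
    rw [hf, hπ₂id d hd, sub_self, map_zero, map_zero, sub_self]
  have hf_perp : ∀ y, ∀ d ∈ N₁, cupProduct h4 (f y) d = 0 := fun y d hd ↦ by
    rw [hf]
    exact hπ₁orth _ d hd
  obtain ⟨γf, hγfalg, hγf⟩ := hT f hf_rat hf_typ hf_N hf_perp
  -- on `T(S₂)`: `F = [γ_f]_*`
  have hFT : ∀ y, (∀ d ∈ N₂, cupProduct h4 y d = 0) → F y = CorrL γf y := by
    intro y hy
    have hπy : π₂ y = 0 := hπ₂T y hy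
    have hπFy : π₁ (F y) = 0 := hπ₁T _ (hF_T y hy)
    have h := hγf y hy
    rw [hf, hπy, sub_zero, hπFy, sub_zero] at h
    rw [hCorrL]
    exact h
  -- `F₁ = F - [γ_f]_*` kills `T(S₂)` and maps `N¹H²(S₂)` into `N¹H²(S₁)`
  set F₁ : complexBetti S₂ (2 * 1) →ₗ[ℂ] complexBetti S₁ (2 * 1) := F - CorrL γf with hF₁def
  have hF₁ : ∀ y, F₁ y = F y - Corr[μ, h₁, h₂ ; γf, y] := fun y ↦ by
    simp only [hF₁def, LinearMap.sub_apply, hCorrL]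
  have hF₁T : ∀ y, (∀ d ∈ N₂, cupProduct h4 y d = 0) → F₁ y = 0 := fun y hy ↦ by
    rw [hF₁, hFT y hy, hCorrL, sub_self]
  obtain ⟨r, d, M, hdQ, hdN, hdli, hspanN, hmulinv, hinvmul⟩ := exists_neronSeveri_gramBasis h₂
  have hmemS : ∀ x ∈ N₂, x ∈ Submodule.span ℂ (Set.range d) := fun x hx ↦ by rw [hspanN]; exact hx
  set c : Fin r → complexBetti S₁ (2 * 1) := fun i ↦ F₁ (d i) with hcdef
  have hcN : ∀ i, c i ∈ N₁ := fun i ↦ by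
    simp only [hcdef, hF₁]
    refine Submodule.sub_mem _ (hL11 _ (hF_rat _ (hdQ i)) (hF_typ 1 1 _ (hN₂11 _ (hdN i)))) ?_
    exact corr_mem_algebraicClasses₂ μ h₁ h₂ hγfalg (hdN i)
  set dv : Fin r → complexBetti S₂ (2 * 1) := fun i ↦ ∑ j, ((M i j : ℚ) : ℂ) • d j with hdvdef
  have hdvN : ∀ i, dv i ∈ N₂ := fun i ↦ Submodule.sum_mem _ fun j _ ↦ Submodule.smul_mem _ _ (hdN j)
  -- the linear map `G₁ y = Σᵢ (∫_{S₂} y ∪ dᵢ^∨) cᵢ` equals `F₁`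
  have hsymm : ∀ x y : complexBetti S₂ (2 * 1), cupProduct h4 x y = cupProduct h4 y x := fun x y ↦ by
    rw [cupProduct_gradedComm_holds ℂ _ h4 h4]
    norm_num
  have htdv : ∀ i k, traceC h₂ (cupProduct h4 (d k) (dv i)) = if i = k then 1 else 0 := by
    intro i k
    simp only [hdvdef, map_sum, map_smul, smul_eq_mul]
    rw [← hinvmul i k]
    refine Finset.sum_congr rfl fun j _ ↦ ?_
    rw [hsymm (d k) (d j)]
  let G₁ : complexBetti S₂ (2 * 1) →ₗ[ℂ] complexBetti S₁ (2 * 1) :=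
    ∑ i, ((traceC h₂) ∘ₗ ((cupProduct h4).flip (dv i))).smulRight (c i)
  have hG₁ : ∀ y, G₁ y = ∑ i, traceC h₂ (cupProduct h4 y (dv i)) • c i := fun y ↦ by
    simp only [G₁, LinearMap.sum_apply, LinearMap.smulRight_apply, LinearMap.comp_apply,
      LinearMap.flip_apply]
  have hG₁d : ∀ k, G₁ (d k) = F₁ (d k) := fun k ↦ by
    rw [hG₁]
    simp_rw [htdv]
    simp [ite_smul, Finset.sum_ite_eq', hcdef]
  have hG₁N : ∀ x ∈ N₂, G₁ x = F₁ x := by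
    intro x hx
    refine Submodule.span_induction (p := fun x _ ↦ G₁ x = F₁ x) ?_ ?_ ?_ ?_ (hmemS x hx)
    · rintro _ ⟨k, rfl⟩
      exact hG₁d k
    · rw [map_zero, map_zero]
    · intro x y _ _ hx hy
      rw [map_add, map_add, hx, hy]
    · intro t x _ hx
      rw [map_smul, map_smul, hx]
  have hG₁T : ∀ y, (∀ e ∈ N₂, cupProduct h4 y e = 0) → G₁ y = 0 := fun y hy ↦ by
    rw [hG₁]
    exact Finset.sum_eq_zero fun i _ ↦ by rw [hy _ (hdvN i), map_zero, zero_smul]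
  have hG₁F₁ : ∀ y, G₁ y = F₁ y := fun y ↦ by
    have hy : y = π₂ y + (y - π₂ y) := by abel
    rw [hy, map_add, map_add, hG₁N _ (hπ₂N y), hG₁T _ (hπ₂orth y), hF₁T _ (hπ₂orth y)]
  -- fibre integration along `pr₁ : S₁ × S₂ → S₁`
  obtain ⟨ω, hω⟩ := exists_traceC_eq_one h₂
  have hω0 : ω ≠ 0 := by
    rintro rfl
    rw [map_zero] at hω
    exact zero_ne_one hω
  obtain ⟨κ, hκ0, hκ⟩ := exists_fibreIntegral_fst μ h₁ h₂ (kunnethSpan_complexBetti h₁ h₂ (2 * (2 + 2)))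
    hω0 (rfl : 2 * 2 + 2 * 2 = 0 + 2 * (2 + 2))
  -- the algebraic class `Γ₁ = Σᵢ pr₁^* cᵢ ∪ pr₂^* dᵢ^∨` acts as `κ G₁`
  set Γ₁ : complexBetti (S₁ ⊗ S₂) (2 * 2) :=
    ∑ i, cupProduct h4 (complexBetti.map (fst S₁ S₂) (2 * 1) (c i)) (complexBetti.map (snd S₁ S₂) (2 * 1) (dv i))
    with hΓ₁def
  have hΓ₁alg : Γ₁ ∈ algebraicClasses (S₁ ⊗ S₂) 2 :=
    Submodule.sum_mem _ fun i _ ↦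
      cupProduct_fst_snd_mem_algebraicClasses_of_eq h₁ h₂ (hcN i) (hdvN i) (rfl : 1 + 1 = 2) h4
  have hΓ₁act : ∀ y, Corr[μ, h₁, h₂ ; Γ₁, y] = κ • G₁ y := by
    intro y
    rw [hG₁, Finset.smul_sum, hΓ₁def, map_sum, map_sum]
    refine Finset.sum_congr rfl fun i _ ↦ ?_
    rw [corrFst_cross_of_cup_eq μ h₁ h₂ h4 (rfl : 2 * 1 + 2 * 2 = 2 * 1 + 2 * 2) h4
      (rfl : 2 * 1 + 2 * 2 + 2 * 2 = 2 * 1 + 2 * (2 + 2)) (rfl : 2 * 2 + 2 * 2 = 0 + 2 * (2 + 2)) hκ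
      (c i) (eq_traceC_smul h₂ hω (cupProduct h4 y (dv i))), smul_smul]
    congr 1
    rw [show ((-1 : ℂ) ^ (2 * 1 * (2 * 1))) = 1 by norm_num, one_mul, mul_comm]
  -- the class `Γ`
  refine ⟨u⁻¹ • (κ⁻¹ • Γ₁ + γf), Submodule.smul_mem _ _
    (Submodule.add_mem _ (Submodule.smul_mem _ _ hΓ₁alg) hγfalg), fun y ↦ ?_⟩
  have hlin : Corr[μ, h₁, h₂ ; u⁻¹ • (κ⁻¹ • Γ₁ + γf), y] =
      u⁻¹ • (κ⁻¹ • Corr[μ, h₁, h₂ ; Γ₁, y] + Corr[μ, h₁, h₂ ; γf, y]) := by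
    simp only [map_add, map_smul]
  rw [hlin, hΓ₁act, smul_smul, inv_mul_cancel₀ hκ0, one_smul, hG₁F₁, hF₁, sub_add_cancel, hF, smul_smul,
    inv_mul_cancel₀ hu0, one_smul]

end Summit.HodgeConjecture.HodgeConjecture.Theorems.SurfaceProducts

end
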